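import Literature.Analysis.Asymptotics.LinearRecurrenceQuadraticSource
import HarnessLib

/-!
# A linear recurrence with a simple dominant root `1` and a CUBIC-polynomial-plus-geometric source: the solution is a QUARTIC polynomial plus a
# geometric error, with the four leading coefficients explicit (module «LINEAR RECURRENCE WITH CUBIC SOURCE»)

Topic `Literature/Analysis/Asymptotics` (continues «LINEAR RECURRENCE WITH QUADRATIC SOURCE» / «… POLYNOMIAL SOURCE» — the quadratic and affine cases,
`Literature.Analysis.exists_norm_sub_cubic_le_of_linearRecurrence_one`, plumbing `norm_tsum_nat_add_le_of_norm_le`, `recDeflate_quadratic` — and «LINEAR RECURRENCE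
DEFLATION — GENERAL ORDER» (`recDeflate`, `exists_norm_le_of_recDeflate`)).  Lane «pcv-sawmu» (CriticalPhenomena venture), a-p2 g29 — the model-free input of the
FOURTH contact cumulant (the `Ĉ⁴` hat sums obey the `det P` recurrence with a cubic source).  Frame: R. P. Stanley, EC1 (2012) §4.1 Theorem 4.1.1 (iii) /
Corollary 4.3.1 (a pole of order `5` at `1` contributes a quartic polynomial); W. Feller I (1968) XIII.6.  Elementary; nothing quoted AS PRINTED.

## What is proved (namespace `Literature.Analysis`)
* §1 `recDeflate_cubic` (deflation of `n ↦ αn³ + βn² + γn + δ`), private Faulhaber sums up to `Σ i³`.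
* §2 ★★★ **`exists_norm_sub_quartic_le_of_linearRecurrence_one`**: `q` monic, roots in `‖z‖ ≤ R < 1`, `Σq_j = Q₁`, `Σjq_j = Q_d`, `Σj²q_j = Q_dd`, `Σj³q_j = Q_ddd`;
  `αQ₁ = ℓ₃`, `βQ₁ = ℓ₂ − 3αQ_d`, `γQ₁ = ℓ₁ − 3αQ_dd − 2βQ_d`, `δQ₁ = ℓ₀ − αQ_ddd − βQ_dd − γQ_d`; source `ℓ₃n³ + ℓ₂n² + ℓ₁n + ℓ₀ + O((n+1)^kRⁿ)` ⇒
  `‖w_n − (α/4·n⁴ + (β/3 − α/2)n³ + (α/4 − β/2 + γ/2)n² + (β/6 − γ/2 + δ)n + m₀)‖ ≤ C'(n+1)^{k+deg q}Rⁿ`.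
* §3 ★★ `exists_abs_sub_quartic_le_of_linearRecurrence_one_real` (real form).

Label: LANE THEOREM (own arrangement of lane «pcv-sawmu», a-p2 g29, 2026-08-28).  NOT claimed: general degree (induction is clear), optimal constants.
-/

noncomputable section

open Finset Filter Topology Polynomial

namespace Literature.Analysis

/-! ## §1 Plumbing -/

/-- Deflation of a cubic sequence: `(∏(S − σ))(n ↦ αn³ + βn² + γn + δ)_n = α(n³Σc + 3n²Σjc + 3nΣj²c + Σj³c) + β(n²Σc + 2nΣjc + Σj²c) + γ(nΣc + Σjc) + δΣc`
(plumbing). [cite: Stanley2012EC1, §4.1 Theorem 4.1.1; lane plumbing] -/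
theorem recDeflate_cubic (rs : List ℂ) (α β γ δ : ℂ) (n : ℕ) :
    recDeflate rs (fun m : ℕ => α * (m : ℂ) ^ 3 + β * (m : ℂ) ^ 2 + γ * (m : ℂ) + δ) n
      = α * ((n : ℂ) ^ 3 * ∑ j ∈ range (rs.length + 1), ((rs.map fun σ => X - C σ).prod).coeff j
          + 3 * (n : ℂ) ^ 2 * ∑ j ∈ range (rs.length + 1), ((rs.map fun σ => X - C σ).prod).coeff j * (j : ℂ)
          + 3 * (n : ℂ) * ∑ j ∈ range (rs.length + 1), ((rs.map fun σ => X - C σ).prod).coeff j * (j : ℂ) ^ 2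
          + ∑ j ∈ range (rs.length + 1), ((rs.map fun σ => X - C σ).prod).coeff j * (j : ℂ) ^ 3)
        + β * ((n : ℂ) ^ 2 * ∑ j ∈ range (rs.length + 1), ((rs.map fun σ => X - C σ).prod).coeff j
          + 2 * (n : ℂ) * ∑ j ∈ range (rs.length + 1), ((rs.map fun σ => X - C σ).prod).coeff j * (j : ℂ)
          + ∑ j ∈ range (rs.length + 1), ((rs.map fun σ => X - C σ).prod).coeff j * (j : ℂ) ^ 2)
        + γ * ((n : ℂ) * ∑ j ∈ range (rs.length + 1), ((rs.map fun σ => X - C σ).prod).coeff j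
          + ∑ j ∈ range (rs.length + 1), ((rs.map fun σ => X - C σ).prod).coeff j * (j : ℂ))
        + δ * ∑ j ∈ range (rs.length + 1), ((rs.map fun σ => X - C σ).prod).coeff j := by
  simp only [recDeflate_eq_sum_coeff]
  have e : ∀ j : ℕ, ((rs.map fun σ => X - C σ).prod).coeff j * (α * ((n + j : ℕ) : ℂ) ^ 3 + β * ((n + j : ℕ) : ℂ) ^ 2 + γ * ((n + j : ℕ) : ℂ) + δ)
      = (α * (n : ℂ) ^ 3 + β * (n : ℂ) ^ 2 + γ * (n : ℂ) + δ) * ((rs.map fun σ => X - C σ).prod).coeff j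
        + (3 * α * (n : ℂ) ^ 2 + 2 * β * (n : ℂ) + γ) * (((rs.map fun σ => X - C σ).prod).coeff j * (j : ℂ))
        + (3 * α * (n : ℂ) + β) * (((rs.map fun σ => X - C σ).prod).coeff j * (j : ℂ) ^ 2)
        + α * (((rs.map fun σ => X - C σ).prod).coeff j * (j : ℂ) ^ 3) := by
    intro j; push_cast; ring
  simp only [e, Finset.sum_add_distrib, ← Finset.mul_sum]
  ring

/-- `4·Σ_{i<n} i³ = n⁴ − 2n³ + n²` over `ℂ` (plumbing, private). [folklore] -/
private theorem four_mul_sum_range_cube_cast_complex (n : ℕ) : 4 * ∑ i ∈ range n, (i : ℂ) ^ 3 = (n : ℂ) ^ 4 - 2 * (n : ℂ) ^ 3 + (n : ℂ) ^ 2 := by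
  induction n with
  | zero => simp
  | succ n ih => rw [Finset.sum_range_succ, mul_add, ih]; push_cast; ring

/-- `6·Σ_{i<n} i² = 2n³ − 3n² + n` over `ℂ` (plumbing, private). [folklore] -/
private theorem six_mul_sum_range_sq_cast_complex' (n : ℕ) : 6 * ∑ i ∈ range n, (i : ℂ) ^ 2 = 2 * (n : ℂ) ^ 3 - 3 * (n : ℂ) ^ 2 + n := by
  induction n with
  | zero => simp
  | succ n ih => rw [Finset.sum_range_succ, mul_add, ih]; push_cast; ring

/-- `2·Σ_{i<n} i = n² − n` over `ℂ` (plumbing, private). [folklore] -/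
private theorem two_mul_sum_range_cast_complex'' (n : ℕ) : 2 * ∑ i ∈ range n, (i : ℂ) = (n : ℂ) ^ 2 - n := by
  induction n with
  | zero => simp
  | succ n ih => rw [Finset.sum_range_succ, mul_add, ih]; push_cast; ring

/-! ## §2 The main theorem: cubic source ⇒ quartic law -/

/-- ★★★ **Linear recurrence with a simple dominant root `1` and a cubic-plus-geometric source.**  `q ∈ ℂ[X]` MONIC, roots in `‖z‖ ≤ R`, `0 < R < 1`;
`Q₁, Q_d, Q_dd, Q_ddd` the coefficient sums `Σq_j, Σjq_j, Σj²q_j, Σj³q_j`; `α, β, γ, δ` with `αQ₁ = ℓ₃`, `βQ₁ = ℓ₂ − 3αQ_d`, `γQ₁ = ℓ₁ − 3αQ_dd − 2βQ_d`,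
`δQ₁ = ℓ₀ − αQ_ddd − βQ_dd − γQ_d`.  If `‖Σ_j q_j(w_{n+1+j} − w_{n+j}) − (ℓ₃n³ + ℓ₂n² + ℓ₁n + ℓ₀)‖ ≤ K(n+1)^kRⁿ` for all `n`, then there are `m₀ ∈ ℂ`, `C' ≥ 0`
with `‖w_n − (α/4·n⁴ + (β/3 − α/2)n³ + (α/4 − β/2 + γ/2)n² + (β/6 − γ/2 + δ)n + m₀)‖ ≤ C'(n+1)^{k+deg q}Rⁿ` for all `n`.
[cite: Stanley2012EC1, §4.1 Theorem 4.1.1 (iii), Corollary 4.3.1; Feller1968, XIII.6; lane statement with explicit leading coefficients] -/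
theorem exists_norm_sub_quartic_le_of_linearRecurrence_one {q : ℂ[X]} (hq : q.Monic) {R : ℝ} (hR : 0 < R) (hR1 : R < 1)
    (hroot : ∀ z : ℂ, q.IsRoot z → ‖z‖ ≤ R) {Q₁ Qd Qdd Qddd : ℂ}
    (hQ₁ : ∑ j ∈ range (q.natDegree + 1), q.coeff j = Q₁) (hQd : ∑ j ∈ range (q.natDegree + 1), q.coeff j * (j : ℂ) = Qd)
    (hQdd : ∑ j ∈ range (q.natDegree + 1), q.coeff j * (j : ℂ) ^ 2 = Qdd) (hQddd : ∑ j ∈ range (q.natDegree + 1), q.coeff j * (j : ℂ) ^ 3 = Qddd)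
    {α β γ δ ℓ₃ ℓ₂ ℓ₁ ℓ₀ : ℂ} (hα : α * Q₁ = ℓ₃) (hβ : β * Q₁ = ℓ₂ - 3 * α * Qd) (hγ : γ * Q₁ = ℓ₁ - 3 * α * Qdd - 2 * β * Qd)
    (hδ : δ * Q₁ = ℓ₀ - α * Qddd - β * Qdd - γ * Qd)
    {w : ℕ → ℂ} {K : ℝ} {k : ℕ} (hK : 0 ≤ K)
    (hw : ∀ n : ℕ, ‖∑ j ∈ range (q.natDegree + 1), q.coeff j * (w (n + 1 + j) - w (n + j))
      - (ℓ₃ * (n : ℂ) ^ 3 + ℓ₂ * (n : ℂ) ^ 2 + ℓ₁ * (n : ℂ) + ℓ₀)‖ ≤ K * ((n : ℝ) + 1) ^ k * R ^ n) :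
    ∃ m₀ : ℂ, ∃ C' : ℝ, 0 ≤ C' ∧ ∀ n : ℕ,
      ‖w n - (α / 4 * (n : ℂ) ^ 4 + (β / 3 - α / 2) * (n : ℂ) ^ 3 + (α / 4 - β / 2 + γ / 2) * (n : ℂ) ^ 2 + (β / 6 - γ / 2 + δ) * (n : ℂ) + m₀)‖
        ≤ C' * ((n : ℝ) + 1) ^ (k + q.natDegree) * R ^ n := by
  set rs : List ℂ := q.roots.toList with hrs
  have hcard : Multiset.card q.roots = q.natDegree := IsAlgClosed.card_roots_eq_natDegree
  have hprod : (rs.map fun σ => X - C σ).prod = q := by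
    have h := prod_multiset_X_sub_C_of_monic_of_roots_card_eq hq hcard
    rw [hrs, ← Multiset.prod_coe, ← Multiset.map_coe, Multiset.coe_toList]
    exact h
  have hlen : rs.length = q.natDegree := by rw [hrs, Multiset.length_toList, hcard]
  have hmem : ∀ σ ∈ rs, ‖σ‖ ≤ R := fun σ hσ => by
    rw [hrs, Multiset.mem_toList, mem_roots hq.ne_zero] at hσ
    exact hroot σ hσ
  set v : ℕ → ℂ := fun n => w (n + 1) - w n - (α * (n : ℂ) ^ 3 + β * (n : ℂ) ^ 2 + γ * (n : ℂ) + δ) with hv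
  have hdefl : ∀ n : ℕ, recDeflate rs v n
      = ∑ j ∈ range (q.natDegree + 1), q.coeff j * (w (n + 1 + j) - w (n + j)) - (ℓ₃ * (n : ℂ) ^ 3 + ℓ₂ * (n : ℂ) ^ 2 + ℓ₁ * (n : ℂ) + ℓ₀) := by
    intro n
    have hsplit : recDeflate rs v n
        = recDeflate rs (fun m => w (m + 1) - w m) n - recDeflate rs (fun m : ℕ => α * (m : ℂ) ^ 3 + β * (m : ℂ) ^ 2 + γ * (m : ℂ) + δ) n := by
      rw [← recDeflate_sub]
    rw [hsplit, recDeflate_cubic, recDeflate_eq_sum_coeff, hprod, hlen, hQ₁, hQd, hQdd, hQddd]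
    have e1 : ∑ j ∈ range (q.natDegree + 1), q.coeff j * (w (n + j + 1) - w (n + j))
        = ∑ j ∈ range (q.natDegree + 1), q.coeff j * (w (n + 1 + j) - w (n + j)) :=
      Finset.sum_congr rfl fun j _ => by rw [show n + j + 1 = n + 1 + j by ring]
    rw [e1]
    have e2 : α * ((n : ℂ) ^ 3 * Q₁ + 3 * (n : ℂ) ^ 2 * Qd + 3 * (n : ℂ) * Qdd + Qddd) + β * ((n : ℂ) ^ 2 * Q₁ + 2 * (n : ℂ) * Qd + Qdd)
        + γ * ((n : ℂ) * Q₁ + Qd) + δ * Q₁ = ℓ₃ * (n : ℂ) ^ 3 + ℓ₂ * (n : ℂ) ^ 2 + ℓ₁ * (n : ℂ) + ℓ₀ := by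
      linear_combination (n : ℂ) ^ 3 * hα + (n : ℂ) ^ 2 * hβ + (n : ℂ) * hγ + hδ
    rw [e2]
  have hvdefl : ∀ n : ℕ, ‖recDeflate rs v n‖ ≤ K * ((n : ℝ) + 1) ^ k * R ^ n := fun n => by rw [hdefl n]; exact hw n
  obtain ⟨C₁, hC₁, hvb⟩ := exists_norm_le_of_recDeflate hR rs hmem k K hK v hvdefl
  rw [hlen] at hvb
  have htail := fun n => norm_tsum_nat_add_le_of_norm_le hR hR1 hC₁ hvb n
  have hvsum : Summable v := (htail 0).1
  set S : ℝ := ∑' j : ℕ, ((j : ℝ) + 1) ^ (k + q.natDegree) * R ^ j with hS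
  have hS0 : 0 ≤ S := tsum_nonneg fun j => by positivity
  have htel : ∀ n : ℕ, w n = w 0 + (α / 4 * ((n : ℂ) ^ 4 - 2 * (n : ℂ) ^ 3 + (n : ℂ) ^ 2) + β / 6 * (2 * (n : ℂ) ^ 3 - 3 * (n : ℂ) ^ 2 + n)
      + γ / 2 * ((n : ℂ) ^ 2 - n) + δ * n) + ∑ i ∈ range n, v i := by
    intro n
    have h1 : ∑ i ∈ range n, (w (i + 1) - w i) = w n - w 0 := Finset.sum_range_sub w n
    have h2 : ∑ i ∈ range n, (w (i + 1) - w i) = ∑ i ∈ range n, (α * (i : ℂ) ^ 3 + β * (i : ℂ) ^ 2 + γ * (i : ℂ) + δ) + ∑ i ∈ range n, v i := by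
      rw [← Finset.sum_add_distrib]; exact Finset.sum_congr rfl fun i _ => by rw [hv]; ring
    have h3 : ∑ i ∈ range n, (α * (i : ℂ) ^ 3 + β * (i : ℂ) ^ 2 + γ * (i : ℂ) + δ)
        = α / 4 * ((n : ℂ) ^ 4 - 2 * (n : ℂ) ^ 3 + (n : ℂ) ^ 2) + β / 6 * (2 * (n : ℂ) ^ 3 - 3 * (n : ℂ) ^ 2 + n) + γ / 2 * ((n : ℂ) ^ 2 - n) + δ * n := by
      rw [Finset.sum_add_distrib, Finset.sum_add_distrib, Finset.sum_add_distrib, ← Finset.mul_sum, ← Finset.mul_sum, ← Finset.mul_sum, Finset.sum_const,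
        card_range, nsmul_eq_mul]
      have s3 := four_mul_sum_range_cube_cast_complex n
      have s2 := six_mul_sum_range_sq_cast_complex' n
      have s1 := two_mul_sum_range_cast_complex'' n
      linear_combination (α / 4) * s3 + (β / 6) * s2 + (γ / 2) * s1
    linear_combination h2 - h1 + h3
  set m₀ : ℂ := w 0 + ∑' i, v i with hm₀
  refine ⟨m₀, C₁ * S, mul_nonneg hC₁ hS0, fun n => ?_⟩
  have hsplit : ∑ i ∈ range n, v i - ∑' i, v i = -∑' i, v (i + n) := by
    rw [← hvsum.sum_add_tsum_nat_add n]; ring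
  have e : w n - (α / 4 * (n : ℂ) ^ 4 + (β / 3 - α / 2) * (n : ℂ) ^ 3 + (α / 4 - β / 2 + γ / 2) * (n : ℂ) ^ 2 + (β / 6 - γ / 2 + δ) * (n : ℂ) + m₀)
      = -∑' i, v (i + n) := by
    rw [← hsplit, htel n, hm₀]
    ring
  rw [e, norm_neg]
  exact (htail n).2

/-! ## §3 Real form -/

/-- ★★ **Real form of §2** (real sequence, real data). [cite: Stanley2012EC1, §4.1 Theorem 4.1.1 (iii), Corollary 4.3.1; Feller1968, XIII.6; lane statement] -/
theorem exists_abs_sub_quartic_le_of_linearRecurrence_one_real {q : ℂ[X]} (hq : q.Monic) {R : ℝ} (hR : 0 < R) (hR1 : R < 1)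
    (hroot : ∀ z : ℂ, q.IsRoot z → ‖z‖ ≤ R) {Q₁ Qd Qdd Qddd : ℝ}
    (hQ₁ : ∑ j ∈ range (q.natDegree + 1), q.coeff j = (Q₁ : ℂ))
    (hQd : ∑ j ∈ range (q.natDegree + 1), q.coeff j * (j : ℂ) = (Qd : ℂ))
    (hQdd : ∑ j ∈ range (q.natDegree + 1), q.coeff j * (j : ℂ) ^ 2 = (Qdd : ℂ))
    (hQddd : ∑ j ∈ range (q.natDegree + 1), q.coeff j * (j : ℂ) ^ 3 = (Qddd : ℂ))
    {α β γ δ ℓ₃ ℓ₂ ℓ₁ ℓ₀ : ℝ} (hα : α * Q₁ = ℓ₃) (hβ : β * Q₁ = ℓ₂ - 3 * α * Qd) (hγ : γ * Q₁ = ℓ₁ - 3 * α * Qdd - 2 * β * Qd)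
    (hδ : δ * Q₁ = ℓ₀ - α * Qddd - β * Qdd - γ * Qd)
    {w : ℕ → ℝ} {K : ℝ} {k : ℕ} (hK : 0 ≤ K)
    (hw : ∀ n : ℕ, ‖∑ j ∈ range (q.natDegree + 1), q.coeff j * (((w (n + 1 + j) : ℝ) : ℂ) - ((w (n + j) : ℝ) : ℂ))
        - (((ℓ₃ : ℝ) : ℂ) * (n : ℂ) ^ 3 + ((ℓ₂ : ℝ) : ℂ) * (n : ℂ) ^ 2 + ((ℓ₁ : ℝ) : ℂ) * (n : ℂ) + ((ℓ₀ : ℝ) : ℂ))‖ ≤ K * ((n : ℝ) + 1) ^ k * R ^ n) :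
    ∃ m₀ : ℝ, ∃ C' : ℝ, 0 ≤ C' ∧ ∀ n : ℕ,
      |w n - (α / 4 * (n : ℝ) ^ 4 + (β / 3 - α / 2) * (n : ℝ) ^ 3 + (α / 4 - β / 2 + γ / 2) * (n : ℝ) ^ 2 + (β / 6 - γ / 2 + δ) * (n : ℝ) + m₀)|
        ≤ C' * ((n : ℝ) + 1) ^ (k + q.natDegree) * R ^ n := by
  have hα' : ((α : ℝ) : ℂ) * (Q₁ : ℂ) = ((ℓ₃ : ℝ) : ℂ) := by exact_mod_cast hα
  have hβ' : ((β : ℝ) : ℂ) * (Q₁ : ℂ) = ((ℓ₂ : ℝ) : ℂ) - 3 * ((α : ℝ) : ℂ) * (Qd : ℂ) := by exact_mod_cast hβ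
  have hγ' : ((γ : ℝ) : ℂ) * (Q₁ : ℂ) = ((ℓ₁ : ℝ) : ℂ) - 3 * ((α : ℝ) : ℂ) * (Qdd : ℂ) - 2 * ((β : ℝ) : ℂ) * (Qd : ℂ) := by exact_mod_cast hγ
  have hδ' : ((δ : ℝ) : ℂ) * (Q₁ : ℂ) = ((ℓ₀ : ℝ) : ℂ) - ((α : ℝ) : ℂ) * (Qddd : ℂ) - ((β : ℝ) : ℂ) * (Qdd : ℂ) - ((γ : ℝ) : ℂ) * (Qd : ℂ) := by
    exact_mod_cast hδ
  obtain ⟨m₀, C', hC', hb⟩ :=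
    exists_norm_sub_quartic_le_of_linearRecurrence_one (w := fun m => ((w m : ℝ) : ℂ)) hq hR hR1 hroot hQ₁ hQd hQdd hQddd hα' hβ' hγ' hδ' hK hw
  refine ⟨m₀.re, C', hC', fun n => ?_⟩
  have h := hb n
  set P : ℝ := α / 4 * (n : ℝ) ^ 4 + (β / 3 - α / 2) * (n : ℝ) ^ 3 + (α / 4 - β / 2 + γ / 2) * (n : ℝ) ^ 2 + (β / 6 - γ / 2 + δ) * (n : ℝ) with hP
  have hPc : ((α : ℝ) : ℂ) / 4 * (n : ℂ) ^ 4 + (((β : ℝ) : ℂ) / 3 - ((α : ℝ) : ℂ) / 2) * (n : ℂ) ^ 3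
      + (((α : ℝ) : ℂ) / 4 - ((β : ℝ) : ℂ) / 2 + ((γ : ℝ) : ℂ) / 2) * (n : ℂ) ^ 2 + (((β : ℝ) : ℂ) / 6 - ((γ : ℝ) : ℂ) / 2 + ((δ : ℝ) : ℂ)) * (n : ℂ)
      = ((P : ℝ) : ℂ) := by
    rw [hP]; push_cast; ring
  have hre : (((w n : ℝ) : ℂ) - (((α : ℝ) : ℂ) / 4 * (n : ℂ) ^ 4 + (((β : ℝ) : ℂ) / 3 - ((α : ℝ) : ℂ) / 2) * (n : ℂ) ^ 3
      + (((α : ℝ) : ℂ) / 4 - ((β : ℝ) : ℂ) / 2 + ((γ : ℝ) : ℂ) / 2) * (n : ℂ) ^ 2 + (((β : ℝ) : ℂ) / 6 - ((γ : ℝ) : ℂ) / 2 + ((δ : ℝ) : ℂ)) * (n : ℂ) + m₀)).re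
      = w n - (P + m₀.re) := by
    rw [hPc, Complex.sub_re, Complex.add_re, Complex.ofReal_re, Complex.ofReal_re]
  rw [← hre]
  exact (Complex.abs_re_le_norm _).trans h

end Literature.Analysis
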